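import Mathlib
import Summits.Ventures.FusionMHD.Models.FluxSurfacePolarRayLevel
import HarnessLib

/-!
# Polar-ray chart, LEVEL direction (V): from CERTIFICATE-SHAPED facts (approximant, residual, slope at the approximant, Lipschitz
# constant of `D_r` on the strip, core margin) to a `LevelPanel` — the generic form of `…QHalfLevel.levelPanel_of_check`

LADDER-GRIDFUSION (F2 item R2 / F1 on the Cerfon–Freidberg rung), cell `gridfusion`, seat `gridfusion-model-7` (g5), 2026-08-27.
Companion of `Models/FluxSurfacePolarRayLevel.lean`.  ★ #117's per-panel certificates (`…QHalfSound.sound_of_ok`, `…QHalfBoxes.BoxData.sound`)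
and their NSTX-like / other-surface twins all deliver the SAME shape of facts on a `θ`-panel `[a, b]` with strip `[s_A, s_max]`:
an approximant `m(θ) ∈ [m⁻, m⁺]`, a residual `|ψ(ray_θ m θ) − u₀| ≤ η`, the radial derivative AT the approximant `D(θ, m θ) ≥ d⁻`,
a Lipschitz constant `M` of `D(θ, ·)` on the strip (from `|∂_s D_r| ≤ M`), the core `0 < s ≤ s_A` below `u₀ − κ`, plus joint continuity
and `HasDerivAt (ψ∘ray_θ) (D θ s) s` on the strip.  `Models/CerfonFreidbergIterLikeQHalfLevel.lean` turned these into a `LevelPanel` for THE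
CF ITER-like instance in one 150-line proof; THIS FILE states that step once, generically, with the rational side conditions as real
hypotheses (`LevelPanel.of_cert`), so every further instance (the NSTX-like twin, other `ψ_N`) gets its `LevelPanel` — hence `q(u)`,
`V′(u)`, `dq/du`, `V″`, `I′` by the Loop/Current files — from a handful of `decide`d inequalities.
Also: `LevelPanel.mono_levels` (shrinking the admissible level interval, for loops whose panels come with different margins).
Elementary real analysis, [folklore].  MODELLED: nothing.  NOT CLAIMED: anything about any equilibrium.
-/

noncomputable section

open Real Set Filter Topology

namespace Summit.Ventures.FusionMHD.Models

namespace PolarRay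

namespace LevelPanel

variable {ψ : ℝ → ℝ → ℝ} {Rc Zc a b s₁ s₂ uin uout : ℝ} {D : ℝ → ℝ → ℝ}

/-- **SHRINKING THE LEVEL INTERVAL**: a `LevelPanel` for `(u_in, u_out)` is one for every sub-interval `(u_in', u_out')`. [folklore] -/
theorem mono_levels (P : LevelPanel ψ Rc Zc a b s₁ s₂ uin uout D) {uin' uout' : ℝ} (h₁ : uin ≤ uin') (h₂ : uout' ≤ uout) :
    LevelPanel ψ Rc Zc a b s₁ s₂ uin' uout' D where
  hab := P.hab
  hs₁ := P.hs₁
  hs₁₂ := P.hs₁₂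
  cont := P.cont
  slope := P.slope
  slopeCont := P.slopeCont
  slopePos := P.slopePos
  inner := fun θ hθ s hs0 hss => (P.inner θ hθ s hs0 hss).trans h₁
  outer := fun θ hθ => h₂.trans (P.outer θ hθ)

end LevelPanel

/-! ## From certificate-shaped facts to a `LevelPanel` -/

section ofCert

variable {ψ : ℝ → ℝ → ℝ} {Rc Zc a b sA smax u₀ : ℝ} {D : ℝ → ℝ → ℝ} {m : ℝ → ℝ}
  {mlo mhi dlo η M r lam κ δ : ℝ}

/-- **`D ≥ λ` ON THE STRIP** from the slope at the approximant, the Lipschitz constant and the two side conditions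
`λ + M(m⁺ − s_A) ≤ d⁻`, `λ + M(s_max − m⁻) ≤ d⁻`. [folklore] -/
theorem slope_lower_of_cert (hm : ∀ θ ∈ Icc a b, mlo ≤ m θ ∧ m θ ≤ mhi) (hsAm : sA ≤ mlo) (hms : mhi ≤ smax)
    (hDm : ∀ θ ∈ Icc a b, dlo ≤ D θ (m θ)) (hM : 0 ≤ M)
    (hLip : ∀ θ ∈ Icc a b, ∀ s ∈ Icc sA smax, ∀ s' ∈ Icc sA smax, |D θ s - D θ s'| ≤ M * |s - s'|)
    (hlam1 : lam + M * (mhi - sA) ≤ dlo) (hlam2 : lam + M * (smax - mlo) ≤ dlo) :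
    ∀ θ ∈ Icc a b, ∀ s ∈ Icc sA smax, lam ≤ D θ s := by
  intro θ hθ s hs
  obtain ⟨hm1, hm2⟩ := hm θ hθ
  have hmI : m θ ∈ Icc sA smax := ⟨hsAm.trans hm1, hm2.trans hms⟩
  have hab := abs_le.1 (hLip θ hθ s hs (m θ) hmI)
  have hD1 := hDm θ hθ
  rcases le_total s (m θ) with hle | hle
  · have habs : |s - m θ| = m θ - s := by rw [abs_of_nonpos (by linarith)]; ring
    rw [habs] at hab
    have : M * (m θ - s) ≤ M * (mhi - sA) := mul_le_mul_of_nonneg_left (by linarith [hs.1]) hM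
    linarith [hab.1, hab.2]
  · have habs : |s - m θ| = s - m θ := abs_of_nonneg (by linarith)
    rw [habs] at hab
    have : M * (s - m θ) ≤ M * (smax - mlo) := mul_le_mul_of_nonneg_left (by linarith [hs.2]) hM
    linarith [hab.1, hab.2]

/-- **OUTER MARGIN FROM RESIDUAL + SLOPE**: with `D ≥ d⁻ − Mr` on the tube `[m, m + r]` (Lipschitz) and the residual `η`,
`ψ(ray (m θ + r)) ≥ u₀ − η + r(d⁻ − Mr)`. [folklore] -/
theorem tube_top_of_cert (hm : ∀ θ ∈ Icc a b, mlo ≤ m θ ∧ m θ ≤ mhi) (hsAm : sA ≤ mlo) (hmr : mhi + r ≤ smax) (hr : 0 < r)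
    (hder : ∀ θ ∈ Icc a b, ∀ s ∈ Icc sA smax, HasDerivAt (rayProfile ψ Rc Zc θ) (D θ s) s)
    (hDm : ∀ θ ∈ Icc a b, dlo ≤ D θ (m θ)) (hM : 0 ≤ M)
    (hLip : ∀ θ ∈ Icc a b, ∀ s ∈ Icc sA smax, ∀ s' ∈ Icc sA smax, |D θ s - D θ s'| ≤ M * |s - s'|)
    (hres : ∀ θ ∈ Icc a b, |rayProfile ψ Rc Zc θ (m θ) - u₀| ≤ η) :
    ∀ θ ∈ Icc a b, u₀ - η + r * (dlo - M * r) ≤ rayProfile ψ Rc Zc θ (m θ + r) := by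
  intro θ hθ
  obtain ⟨hm1, hm2⟩ := hm θ hθ
  have hmI : m θ ∈ Icc sA smax := ⟨hsAm.trans hm1, by linarith⟩
  have htube : ∀ s ∈ Icc (m θ) (m θ + r), s ∈ Icc sA smax := fun s hs => ⟨by linarith [hs.1], by linarith [hs.2]⟩
  have hslope : ∀ s ∈ Icc (m θ) (m θ + r), dlo - M * r ≤ D θ s := by
    intro s hs
    have hL := hLip θ hθ s (htube s hs) (m θ) hmI
    have hsm : |s - m θ| ≤ r := abs_le.2 ⟨by linarith [hs.1], by linarith [hs.2]⟩
    have h1 := abs_le.1 (le_trans hL (mul_le_mul_of_nonneg_left hsm hM))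
    linarith [hDm θ hθ]
  have hcont : ContinuousOn (rayProfile ψ Rc Zc θ) (Icc (m θ) (m θ + r)) :=
    fun s hs => (hder θ hθ s (htube s hs)).continuousAt.continuousWithinAt
  have hdiff : DifferentiableOn ℝ (rayProfile ψ Rc Zc θ) (interior (Icc (m θ) (m θ + r))) := by
    rw [interior_Icc]
    exact fun s hs => (hder θ hθ s (htube s (Ioo_subset_Icc_self hs))).differentiableAt.differentiableWithinAt
  have hge : ∀ s ∈ interior (Icc (m θ) (m θ + r)), dlo - M * r ≤ deriv (rayProfile ψ Rc Zc θ) s := by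
    rw [interior_Icc]; intro s hs
    rw [(hder θ hθ s (htube s (Ioo_subset_Icc_self hs))).deriv]
    exact hslope s (Ioo_subset_Icc_self hs)
  have hmv := (convex_Icc (m θ) (m θ + r)).mul_sub_le_image_sub_of_le_deriv hcont hdiff hge
    (m θ) ⟨le_rfl, by linarith⟩ (m θ + r) ⟨by linarith, le_rfl⟩ (by linarith)
  have hres' := (abs_le.1 (hres θ hθ)).1
  have e : (dlo - M * r) * (m θ + r - m θ) = r * (dlo - M * r) := by ring
  rw [e] at hmv
  linarith

/-- **CERTIFICATE-SHAPED FACTS ⇒ `LevelPanel`.**  On a `θ`-panel `[a, b]` with strip `[s_A, s_max]` (`0 < s_A ≤ s_max`): joint continuity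
of the ray profile and of `D`, `HasDerivAt (ψ∘ray_θ) (D θ s) s` on the strip, a Lipschitz constant `M ≥ 0` of `D(θ, ·)` there, an
approximant `m(θ) ∈ [m⁻, m⁺]` with residual `≤ η` and `D(θ, m θ) ≥ d⁻`, the core `0 < s ≤ s_A` below `u₀ − κ`, and the numeric side
conditions `s_A + r ≤ m⁻`, `m⁺ + r ≤ s_max`, `0 < r`, `0 < λ`, `λ + M(m⁺ − s_A) ≤ d⁻`, `λ + M(s_max − m⁻) ≤ d⁻`, `δ ≤ κ`,
`δ + η ≤ r(d⁻ − Mr)` — give the panel hypotheses with level margins for the levels `(u₀ − δ, u₀ + δ)`. [folklore] -/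
theorem LevelPanel.of_cert (hab : a ≤ b) (hsA : 0 < sA) (hsAs : sA ≤ smax)
    (hF : ContinuousOn (fun p : ℝ × ℝ => rayProfile ψ Rc Zc p.1 p.2) (Icc a b ×ˢ Icc sA smax))
    (hDc : ContinuousOn (fun p : ℝ × ℝ => D p.1 p.2) (Icc a b ×ˢ Icc sA smax))
    (hder : ∀ θ ∈ Icc a b, ∀ s ∈ Icc sA smax, HasDerivAt (rayProfile ψ Rc Zc θ) (D θ s) s)
    (hM : 0 ≤ M) (hLip : ∀ θ ∈ Icc a b, ∀ s ∈ Icc sA smax, ∀ s' ∈ Icc sA smax, |D θ s - D θ s'| ≤ M * |s - s'|)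
    (hm : ∀ θ ∈ Icc a b, mlo ≤ m θ ∧ m θ ≤ mhi) (hres : ∀ θ ∈ Icc a b, |rayProfile ψ Rc Zc θ (m θ) - u₀| ≤ η)
    (hDm : ∀ θ ∈ Icc a b, dlo ≤ D θ (m θ))
    (hcore : ∀ θ ∈ Icc a b, ∀ s, 0 < s → s ≤ sA → rayProfile ψ Rc Zc θ s ≤ u₀ - κ)
    (hsAr : sA + r ≤ mlo) (hmr : mhi + r ≤ smax) (hr : 0 < r) (hlam : 0 < lam)
    (hlam1 : lam + M * (mhi - sA) ≤ dlo) (hlam2 : lam + M * (smax - mlo) ≤ dlo)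
    (hδκ : δ ≤ κ) (hδout : δ + η ≤ r * (dlo - M * r)) :
    LevelPanel ψ Rc Zc a b sA smax (u₀ - δ) (u₀ + δ) D := by
  have hsAm : sA ≤ mlo := by linarith
  have hms : mhi ≤ smax := by linarith
  have hDstrip := slope_lower_of_cert hm hsAm hms hDm hM hLip hlam1 hlam2
  have htop := tube_top_of_cert hm hsAm hmr hr hder hDm hM hLip hres
  -- strict monotonicity on the strip
  have hcontF : ∀ θ ∈ Icc a b, ContinuousOn (rayProfile ψ Rc Zc θ) (Icc sA smax) :=
    fun θ hθ s hs => (hder θ hθ s hs).continuousAt.continuousWithinAt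
  have hmono : ∀ θ ∈ Icc a b, StrictMonoOn (rayProfile ψ Rc Zc θ) (Icc sA smax) := by
    intro θ hθ
    apply strictMonoOn_rayProfile_of_deriv_pos (hcontF θ hθ)
    intro s hs
    rw [(hder θ hθ s (Ioo_subset_Icc_self hs)).deriv]
    exact hlam.trans_le (hDstrip θ hθ s (Ioo_subset_Icc_self hs))
  exact
    { hab := hab
      hs₁ := hsA
      hs₁₂ := hsAs
      cont := hF
      slope := hder
      slopeCont := hDc
      slopePos := fun θ hθ s hs => hlam.trans_le (hDstrip θ hθ s hs)
      inner := fun θ hθ s hs0 hss => (hcore θ hθ s hs0 hss).trans (by linarith)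
      outer := fun θ hθ => by
        obtain ⟨hm1, hm2⟩ := hm θ hθ
        have hle := (hmono θ hθ).monotoneOn ⟨by linarith, by linarith⟩ ⟨hsAs, le_rfl⟩ (show m θ + r ≤ smax by linarith)
        exact le_trans (by linarith [htop θ hθ]) hle }

/-- The Lipschitz hypothesis from a second-derivative bound: `HasDerivAt (D θ) (D₁ θ s) s` and `|D₁| ≤ M` on the strip give
`|D(θ, s) − D(θ, s′)| ≤ M|s − s′|` (mean value inequality). [folklore] -/
theorem lipschitz_of_deriv_bound {D₁ : ℝ → ℝ → ℝ}
    (hD₁ : ∀ θ ∈ Icc a b, ∀ s ∈ Icc sA smax, HasDerivAt (D θ) (D₁ θ s) s)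
    (hB : ∀ θ ∈ Icc a b, ∀ s ∈ Icc sA smax, |D₁ θ s| ≤ M) :
    ∀ θ ∈ Icc a b, ∀ s ∈ Icc sA smax, ∀ s' ∈ Icc sA smax, |D θ s - D θ s'| ≤ M * |s - s'| := by
  intro θ hθ s hs s' hs'
  have h := Convex.norm_image_sub_le_of_norm_hasDerivWithin_le (f := fun x => D θ x) (f' := fun x => D₁ θ x)
    (s := Icc sA smax) (fun x hx => (hD₁ θ hθ x hx).hasDerivWithinAt)
    (fun x hx => by rw [Real.norm_eq_abs]; exact hB θ hθ x hx) (convex_Icc _ _) hs' hs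
  rw [Real.norm_eq_abs, Real.norm_eq_abs] at h
  exact h

end ofCert

end PolarRay

end Summit.Ventures.FusionMHD.Models

end
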